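import Summits.AtomisticToContinuum.BoseEinsteinCondensation.Theorems.BECConjugateDominationPositiveMinimiserFinal
import Mathlib.Analysis.SpecialFunctions.SmoothTransition
import HarnessLib

/-!
# A smooth pair cut-off removing the hard-core shell: stub `stub_pairCutoffExists` of line
# `third-law-current-floor`, crux `BECConjugateDomination.HardCoreExtension` (stmt-…-11786)

For `N` particles on `ℝ³/Lℤ³`, a core radius `a > 0` and a shell width `ℓ ∈ (0, a]` we build a
`C¹`, `Lℤ³`-periodic, Bose-symmetric `χ : (ℝ³)^N → [0, 1]` with `χ = 0` as soon as some image pair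
distance `|xᵢ - xⱼ - Ln|` is `≤ a`, `χ = 1` when all of them are `≥ a + ℓ`, `|∇χ|² ≤ C(N, L, a)/ℓ²`,
and `∇χ = 0` when no image pair distance lies in the shell `(a, a + ℓ)`. Construction:
`χ = smoothTransition ∘ (1 - H)` with `H = (∑_{i<j} w^per(xᵢ - xⱼ)).toReal`, `w(r) = φ(r²)`,
`φ(s) = smoothTransition(((a+ℓ)² - s)/d)`, `d = (a+ℓ)² - a²` (a smooth step in the SQUARED
distance, `|φ'| ≤ M₁/d`). Locally `H` is a finite sum; each term has derivative
`φ'(|y|²) 2⟨y, vᵢ - vⱼ⟩` with `|y| < a + ℓ` on the support of `φ'`, and at most `K(L, a)` lattice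
images of a point lie in a ball of radius `2a` (uniformly in the point), whence
`|∂χ| ≤ M₁ · N²K · (M₁/d) · 4(a+ℓ) ≤ 4N²KM₁²/ℓ`. Standard smooth IMS-type cut-off. [folklore]
-/

noncomputable section

namespace Summit.AtomisticToContinuum.BoseEinsteinCondensation.Cruxes.HardCoreExtension.ThirdLawCurrentFloor

open MeasureTheory Filter
open scoped ENNReal NNReal BigOperators Topology RealInnerProductSpace
open Literature.MathematicalPhysics.QuantumManyBody.BoseGas
open Summit.AtomisticToContinuum.BoseEinsteinCondensation.Theorems.PositiveMinimiser

/-! ### The profile in the squared distance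

The derivative facts for `Real.smoothTransition` (`deriv_smoothTransition_of_nonpos`,
`deriv_smoothTransition_of_one_le`, `exists_bound_deriv_smoothTransition`) are those of
`PeriodicBoseGasScattering.lean`. -/

/-- **A smooth step in the squared distance**: for `0 < a`, `0 < ℓ` a `C¹` profile
`φ : ℝ → [0, 1]`, `φ = 1` on `(-∞, a²]`, `φ = 0` on `[(a+ℓ)², ∞)`, with `|φ'| ≤ M₁/((a+ℓ)² - a²)`
(`M₁` any bound of the derivative of `Real.smoothTransition`) and `φ' = 0` off `(a², (a+ℓ)²)`;
namely `φ(s) = smoothTransition(((a+ℓ)² - s)/((a+ℓ)² - a²))`. [folklore] -/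
theorem exists_sqProfile {a ℓ M₁ : ℝ} (ha : 0 < a) (hℓ : 0 < ℓ)
    (hM₁ : ∀ t, |deriv Real.smoothTransition t| ≤ M₁) :
    ∃ φ : ℝ → ℝ, ContDiff ℝ 1 φ ∧ (∀ s, 0 ≤ φ s) ∧ (∀ s, φ s ≤ 1) ∧
      (∀ s, s ≤ a ^ 2 → φ s = 1) ∧ (∀ s, (a + ℓ) ^ 2 ≤ s → φ s = 0) ∧
      (∀ s, |deriv φ s| ≤ M₁ / ((a + ℓ) ^ 2 - a ^ 2)) ∧
      (∀ s, s ≤ a ^ 2 ∨ (a + ℓ) ^ 2 ≤ s → deriv φ s = 0) := by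
  set d : ℝ := (a + ℓ) ^ 2 - a ^ 2 with hd
  have hd0 : 0 < d := by rw [hd]; nlinarith
  have hC : ContDiff ℝ 1 Real.smoothTransition := Real.smoothTransition.contDiff
  have hderiv : ∀ s, HasDerivAt (fun s => Real.smoothTransition (((a + ℓ) ^ 2 - s) / d))
      (deriv Real.smoothTransition (((a + ℓ) ^ 2 - s) / d) * ((0 - 1) / d)) s := fun s =>
    ((hC.differentiable one_ne_zero) _).hasDerivAt.comp s
      (((hasDerivAt_const s _).sub (hasDerivAt_id s)).div_const _)
  have hA1 : ∀ s, s ≤ a ^ 2 → 1 ≤ ((a + ℓ) ^ 2 - s) / d := fun s hs => by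
    rw [le_div_iff₀ hd0, hd]; linarith
  have hA0 : ∀ s, (a + ℓ) ^ 2 ≤ s → ((a + ℓ) ^ 2 - s) / d ≤ 0 := fun s hs =>
    div_nonpos_of_nonpos_of_nonneg (by linarith) hd0.le
  refine ⟨fun s => Real.smoothTransition (((a + ℓ) ^ 2 - s) / d),
    hC.comp ((contDiff_const.sub contDiff_id).div_const _),
    fun s => Real.smoothTransition.nonneg _, fun s => Real.smoothTransition.le_one _,
    fun s hs => Real.smoothTransition.one_of_one_le (hA1 s hs),
    fun s hs => Real.smoothTransition.zero_of_nonpos (hA0 s hs), fun s => ?_, fun s hs => ?_⟩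
  · rw [(hderiv s).deriv, abs_mul, mul_comm, zero_sub, abs_div, abs_neg, abs_one,
      abs_of_pos hd0, one_div_mul_eq_div]
    exact div_le_div_of_nonneg_right (hM₁ _) hd0.le
  · rw [(hderiv s).deriv]
    rcases hs with hs | hs
    · rw [deriv_smoothTransition_of_one_le (hA1 s hs), zero_mul]
    · rw [deriv_smoothTransition_of_nonpos (hA0 s hs), zero_mul]

/-! ### Uniform local finiteness of the period lattice -/

/-- **Uniform local finiteness of `Lℤ³`**: the number of lattice points within distance `R` of a
point of `ℝ³` is bounded independently of the point (two such lattice points differ by a lattice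
vector of length `≤ 2R`). [folklore] -/
theorem exists_card_latticeVec_near_le {L : ℝ} (hL : 0 < L) (R : ℝ) :
    ∃ K : ℕ, ∀ (y : Space) (s : Finset (Fin 3 → ℤ)),
      (∀ n ∈ s, ‖y - latticeVec L n‖ ≤ R) → s.card ≤ K := by
  refine ⟨(finite_latticeVec_near hL 0 (R + R)).toFinset.card, fun y s hs => ?_⟩
  rcases s.eq_empty_or_nonempty with rfl | ⟨m, hm⟩
  · simp
  refine Finset.card_le_card_of_injOn (fun n => n - m) (fun n hn => ?_) sub_left_injective.injOn
  rw [Finset.mem_coe] at hn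
  rw [Set.Finite.coe_toFinset, Set.mem_setOf_eq, latticeVec_sub, zero_sub, neg_sub]
  calc ‖latticeVec L m - latticeVec L n‖ = ‖(y - latticeVec L n) - (y - latticeVec L m)‖ := by
        congr 1; abel
    _ ≤ ‖y - latticeVec L n‖ + ‖y - latticeVec L m‖ := norm_sub_le _ _
    _ ≤ R + R := add_le_add (hs n hn) (hs m hm)

/-! ### The smooth periodic pair sum `H = (∑_{i<j} w^per(xᵢ - xⱼ)).toReal`, `w(r) = φ(r²)` -/

/-- Chain rule for a pair factor `X ↦ g(|xᵢ - xⱼ - c|²)`: its derivative at `X₀` along `v` is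
`g'(|y₀|²) · 2⟨y₀, vᵢ - vⱼ⟩`, `y₀ = xᵢ⁰ - xⱼ⁰ - c`. [folklore] -/
theorem exists_hasFDerivAt_pairSq {N : ℕ} {g : ℝ → ℝ} {g' : ℝ} (i j : Fin N) (c : Space)
    (X₀ : Config N) (hg : HasDerivAt g g' (‖X₀ i - X₀ j - c‖ ^ 2)) :
    ∃ D : Config N →L[ℝ] ℝ, HasFDerivAt (fun X : Config N => g (‖X i - X j - c‖ ^ 2)) D X₀ ∧
      ∀ v, D v = g' * (2 * ⟪X₀ i - X₀ j - c, v i - v j⟫) := by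
  have h1 : HasFDerivAt (fun X : Config N => X i - X j - c)
      (ContinuousLinearMap.proj (R := ℝ) (φ := fun _ : Fin N => Space) i -
        ContinuousLinearMap.proj (R := ℝ) (φ := fun _ : Fin N => Space) j) X₀ :=
    ((hasFDerivAt_apply i X₀).sub (hasFDerivAt_apply j X₀)).sub_const c
  refine ⟨_, hg.comp_hasFDerivAt X₀ h1.norm_sq, fun v => ?_⟩
  simp only [smul_apply, ContinuousLinearMap.comp_apply, sub_apply,
    ContinuousLinearMap.proj_apply, innerSL_apply_apply, smul_eq_mul, nsmul_eq_mul, Nat.cast_ofNat]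

/-- One image pair term is dominated by the whole periodic interaction: for `i ≠ j` and every
lattice vector `Ln`, `w(|xᵢ - xⱼ - Ln|) ≤ W(X)` (for `j < i` pass to the pair `(j, i)` and `-n`).
[folklore] -/
theorem apply_le_periodicInteraction {N : ℕ} (w : ℝ → ℝ≥0∞) (L : ℝ) (X : Config N) {i j : Fin N}
    (hij : i ≠ j) (n : Fin 3 → ℤ) :
    w ‖X i - X j - latticeVec L n‖ ≤ periodicInteraction w L X := by
  have key : ∀ {i j : Fin N}, i < j → ∀ n : Fin 3 → ℤ,
      w ‖X i - X j - latticeVec L n‖ ≤ periodicInteraction w L X := by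
    intro i j h n
    unfold periodicInteraction
    calc w ‖X i - X j - latticeVec L n‖ ≤ periodizedPotential w L (X i - X j) := by
          unfold periodizedPotential; exact ENNReal.le_tsum n
      _ ≤ ∑ j' : Fin N with i < j', periodizedPotential w L (X i - X j') :=
          Finset.single_le_sum (f := fun j' => periodizedPotential w L (X i - X j'))
            (fun _ _ => zero_le) (Finset.mem_filter.2 ⟨Finset.mem_univ _, h⟩)
      _ ≤ ∑ i' : Fin N, ∑ j' : Fin N with i' < j', periodizedPotential w L (X i' - X j') :=
          Finset.single_le_sum
            (f := fun i' => ∑ j' : Fin N with i' < j', periodizedPotential w L (X i' - X j'))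
            (fun _ _ => zero_le) (Finset.mem_univ _)
  rcases lt_or_gt_of_ne hij with h | h
  · exact key h n
  · rw [show ‖X i - X j - latticeVec L n‖ = ‖X j - X i - latticeVec L (-n)‖ by
      rw [latticeVec_neg, sub_neg_eq_add, ← norm_neg]; congr 1; abel]
    exact key h (-n)

/-- If every image pair term vanishes, so does the periodic interaction. [folklore] -/
theorem periodicInteraction_eq_zero_of_forall {N : ℕ} (w : ℝ → ℝ≥0∞) (L : ℝ) (X : Config N)
    (h : ∀ i j : Fin N, i ≠ j → ∀ n : Fin 3 → ℤ, w ‖X i - X j - latticeVec L n‖ = 0) :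
    periodicInteraction w L X = 0 := by
  refine Finset.sum_eq_zero fun i _ => Finset.sum_eq_zero fun j hj => ?_
  exact ENNReal.tsum_eq_zero.2 fun n => h i j (Finset.mem_filter.1 hj).2.ne n

/-- **Local differentiation of the smooth pair sum.** For a `C¹` profile `φ ≥ 0` vanishing on
`[ρ², ∞)` (`ρ ≥ 0`), the real pair sum `H(X) = (∑_{i<j} w^per(xᵢ - xⱼ)).toReal`, `w(r) = φ(r²)`,
is differentiable with `DH(X₀) v = ∑_{i<j} ∑_{n ∈ S_{ij}} φ'(|y₀|²) · 2⟨y₀, vᵢ - vⱼ⟩`,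
`y₀ = xᵢ⁰ - xⱼ⁰ - Ln`, `S_{ij} = {n : |xᵢ⁰ - xⱼ⁰ - Ln| ≤ ρ + 1}` (near `X₀` only these images
contribute). [folklore] -/
theorem exists_hasFDerivAt_toReal_periodicInteraction {N : ℕ} {L : ℝ} (hL : 0 < L) {φ : ℝ → ℝ}
    (hφC : ContDiff ℝ 1 φ) (hφ0 : ∀ s, 0 ≤ φ s) {ρ : ℝ} (hρ : 0 ≤ ρ)
    (hφρ : ∀ s, ρ ^ 2 ≤ s → φ s = 0) (X₀ : Config N) :
    ∃ D : Config N →L[ℝ] ℝ,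
      HasFDerivAt (fun X : Config N =>
        (periodicInteraction (fun r => ENNReal.ofReal (φ (r ^ 2))) L X).toReal) D X₀ ∧
      ∀ v, D v = ∑ i : Fin N, ∑ j : Fin N with i < j,
        ∑ n ∈ (finite_latticeVec_near hL (X₀ i - X₀ j) (ρ + 1)).toFinset,
          deriv φ (‖X₀ i - X₀ j - latticeVec L n‖ ^ 2) *
            (2 * ⟪X₀ i - X₀ j - latticeVec L n, v i - v j⟫) := by
  have hwR : ∀ r, ρ < r → ENNReal.ofReal (φ (r ^ 2)) = 0 := fun r hr => by
    rw [hφρ _ (pow_le_pow_left₀ hρ hr.le 2), ENNReal.ofReal_zero]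
  have hwfin : ∀ r, ENNReal.ofReal (φ (r ^ 2)) ≠ ⊤ := fun _ => ENNReal.ofReal_ne_top
  choose Dp hDp hDpv using fun (i j : Fin N) (n : Fin 3 → ℤ) =>
    exists_hasFDerivAt_pairSq (g := φ) i j (latticeVec L n) X₀
      ((hφC.differentiable one_ne_zero) _).hasDerivAt
  refine ⟨∑ i : Fin N, ∑ j : Fin N with i < j,
      ∑ n ∈ (finite_latticeVec_near hL (X₀ i - X₀ j) (ρ + 1)).toFinset, Dp i j n, ?_, fun v => ?_⟩
  · have hloc : (fun X : Config N =>
          (periodicInteraction (fun r => ENNReal.ofReal (φ (r ^ 2))) L X).toReal) =ᶠ[𝓝 X₀]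
        fun X => ∑ i : Fin N, ∑ j : Fin N with i < j,
          ∑ n ∈ (finite_latticeVec_near hL (X₀ i - X₀ j) (ρ + 1)).toFinset,
            φ (‖X i - X j - latticeVec L n‖ ^ 2) := by
      filter_upwards [Metric.ball_mem_nhds X₀ one_half_pos] with X hX
      unfold periodicInteraction
      rw [ENNReal.toReal_sum fun _ _ => ENNReal.sum_ne_top.2 fun _ _ =>
        periodizedPotential_ne_top hL hwR hwfin _]
      refine Finset.sum_congr rfl fun i _ => ?_
      rw [ENNReal.toReal_sum fun _ _ => periodizedPotential_ne_top hL hwR hwfin _]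
      refine Finset.sum_congr rfl fun j _ => ?_
      have hx : X i - X j ∈ Metric.ball (X₀ i - X₀ j) 1 := by
        rw [Metric.mem_ball, dist_eq_norm] at hX ⊢
        calc ‖X i - X j - (X₀ i - X₀ j)‖ = ‖(X - X₀) i - (X - X₀) j‖ := by
              simp only [Pi.sub_apply]; congr 1; abel
          _ ≤ ‖(X - X₀) i‖ + ‖(X - X₀) j‖ := norm_sub_le _ _
          _ ≤ ‖X - X₀‖ + ‖X - X₀‖ := add_le_add (norm_le_pi_norm _ i) (norm_le_pi_norm _ j)
          _ < 1 := by linarith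
      rw [toReal_periodizedPotential_eq_of_mem_ball hL hwR hwfin (X₀ i - X₀ j) hx]
      exact Finset.sum_congr rfl fun n _ => ENNReal.toReal_ofReal (hφ0 _)
    refine HasFDerivAt.congr_of_eventuallyEq ?_ hloc
    exact HasFDerivAt.fun_sum fun i _ => HasFDerivAt.fun_sum fun j _ =>
      HasFDerivAt.fun_sum fun n _ => hDp i j n
  · simp only [sum_apply, hDpv]

/-- **Gradient bound for the smooth pair sum.** If moreover `|φ'| ≤ B`, `φ' = 0` on `[ρ², ∞)` and
at most `K` lattice images of any point lie in a ball of radius `ρ`, then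
`|DH(X₀) v| ≤ N² K · B · 2ρ · 2‖v‖` for every `X₀` and `v`. [folklore] -/
theorem abs_fderiv_toReal_periodicInteraction_le {N : ℕ} {L : ℝ} (hL : 0 < L) {φ : ℝ → ℝ}
    (hφC : ContDiff ℝ 1 φ) (hφ0 : ∀ s, 0 ≤ φ s) {ρ : ℝ} (hρ : 0 ≤ ρ)
    (hφρ : ∀ s, ρ ^ 2 ≤ s → φ s = 0) (hφ'ρ : ∀ s, ρ ^ 2 ≤ s → deriv φ s = 0)
    {B : ℝ} (hB0 : 0 ≤ B) (hB : ∀ s, |deriv φ s| ≤ B) {K : ℕ}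
    (hK : ∀ (y : Space) (s : Finset (Fin 3 → ℤ)),
      (∀ n ∈ s, ‖y - latticeVec L n‖ ≤ ρ) → s.card ≤ K)
    (X₀ v : Config N) :
    |fderiv ℝ (fun X : Config N =>
        (periodicInteraction (fun r => ENNReal.ofReal (φ (r ^ 2))) L X).toReal) X₀ v| ≤
      (N : ℝ) ^ 2 * K * (B * (2 * (ρ * (2 * ‖v‖)))) := by
  obtain ⟨D, hD, hDv⟩ := exists_hasFDerivAt_toReal_periodicInteraction hL hφC hφ0 hρ hφρ X₀
  rw [hD.fderiv, hDv]
  have hblock : ∀ i j : Fin N,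
      |∑ n ∈ (finite_latticeVec_near hL (X₀ i - X₀ j) (ρ + 1)).toFinset,
          deriv φ (‖X₀ i - X₀ j - latticeVec L n‖ ^ 2) *
            (2 * ⟪X₀ i - X₀ j - latticeVec L n, v i - v j⟫)| ≤
        K * (B * (2 * (ρ * (2 * ‖v‖)))) := by
    intro i j
    rw [← Finset.sum_filter_of_ne (p := fun n => ‖X₀ i - X₀ j - latticeVec L n‖ < ρ)
      (fun n _ hne => ?_)]
    · refine (Finset.abs_sum_le_sum_abs _ _).trans ?_
      refine (Finset.sum_le_card_nsmul _ _ (B * (2 * (ρ * (2 * ‖v‖)))) fun n hn => ?_).trans ?_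
      · rw [Finset.mem_filter] at hn
        rw [abs_mul, abs_mul, abs_two]
        refine mul_le_mul (hB _) (mul_le_mul_of_nonneg_left ?_ zero_le_two) (by positivity) hB0
        refine (abs_real_inner_le_norm _ _).trans ?_
        refine mul_le_mul (le_of_lt hn.2) ((norm_sub_le _ _).trans ?_) (norm_nonneg _) hρ
        rw [two_mul]; exact add_le_add (norm_le_pi_norm v i) (norm_le_pi_norm v j)
      · rw [nsmul_eq_mul]
        refine mul_le_mul_of_nonneg_right ?_ (by positivity)
        exact_mod_cast hK (X₀ i - X₀ j) _ fun n hn => le_of_lt (Finset.mem_filter.1 hn).2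
    · by_contra hge
      refine hne ?_
      rw [hφ'ρ _ (pow_le_pow_left₀ hρ (not_lt.1 hge) 2), zero_mul]
  have hb0 : 0 ≤ (K : ℝ) * (B * (2 * (ρ * (2 * ‖v‖)))) := by positivity
  calc |∑ i : Fin N, ∑ j : Fin N with i < j,
          ∑ n ∈ (finite_latticeVec_near hL (X₀ i - X₀ j) (ρ + 1)).toFinset,
            deriv φ (‖X₀ i - X₀ j - latticeVec L n‖ ^ 2) *
              (2 * ⟪X₀ i - X₀ j - latticeVec L n, v i - v j⟫)|
      ≤ ∑ i : Fin N, ∑ j : Fin N with i < j, (K : ℝ) * (B * (2 * (ρ * (2 * ‖v‖)))) := by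
        refine (Finset.abs_sum_le_sum_abs _ _).trans (Finset.sum_le_sum fun i _ => ?_)
        exact (Finset.abs_sum_le_sum_abs _ _).trans (Finset.sum_le_sum fun j _ => hblock i j)
    _ ≤ ∑ _i : Fin N, ∑ _j : Fin N, (K : ℝ) * (B * (2 * (ρ * (2 * ‖v‖)))) :=
        Finset.sum_le_sum fun i _ => Finset.sum_le_sum_of_subset_of_nonneg
          (Finset.filter_subset _ _) fun _ _ _ => hb0
    _ = (N : ℝ) ^ 2 * K * (B * (2 * (ρ * (2 * ‖v‖)))) := by
        simp only [Finset.sum_const, Finset.card_univ, Fintype.card_fin, nsmul_eq_mul]; ring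

/-- **The gradient of the smooth pair sum vanishes off the shells**: if `φ'(|xᵢ⁰ - xⱼ⁰ - Ln|²) = 0`
for all `i ≠ j` and all `n`, then `DH(X₀) = 0`. [folklore] -/
theorem fderiv_toReal_periodicInteraction_eq_zero {N : ℕ} {L : ℝ} (hL : 0 < L) {φ : ℝ → ℝ}
    (hφC : ContDiff ℝ 1 φ) (hφ0 : ∀ s, 0 ≤ φ s) {ρ : ℝ} (hρ : 0 ≤ ρ)
    (hφρ : ∀ s, ρ ^ 2 ≤ s → φ s = 0) (X₀ : Config N)
    (h0 : ∀ i j : Fin N, i ≠ j → ∀ n : Fin 3 → ℤ,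
      deriv φ (‖X₀ i - X₀ j - latticeVec L n‖ ^ 2) = 0) :
    fderiv ℝ (fun X : Config N =>
        (periodicInteraction (fun r => ENNReal.ofReal (φ (r ^ 2))) L X).toReal) X₀ = 0 := by
  obtain ⟨D, hD, hDv⟩ := exists_hasFDerivAt_toReal_periodicInteraction hL hφC hφ0 hρ hφρ X₀
  rw [hD.fderiv]; ext v; rw [hDv, zero_apply]
  refine Finset.sum_eq_zero fun i _ => Finset.sum_eq_zero fun j hj =>
    Finset.sum_eq_zero fun n _ => ?_
  rw [h0 i j (Finset.mem_filter.1 hj).2.ne n, zero_mul]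

/-! ### The cut-off -/

/-- **Smooth pair cut-off removing the hard-core shell** (stub `stub_pairCutoffExists`, node E2 of
the `C¹`-cut-off scheme): for `0 < L`, `0 < a` there is `C = C(N, L, a) ≥ 0` such that for every
shell width `ℓ ∈ (0, a]` there is a `C¹`, `Lℤ³`-periodic, Bose-symmetric `χ : (ℝ³)^N → [0, 1]`
vanishing whenever some image pair distance is `≤ a`, equal to `1` when all image pair distances
are `≥ a + ℓ`, with `|∇χ|² ≤ C/ℓ²` everywhere and `∇χ = 0` off the shells. [folklore] -/
theorem stub_pairCutoffExists :
    ∀ (N : ℕ) (L a : ℝ), 0 < L → 0 < a → ∃ C : ℝ, 0 ≤ C ∧ ∀ ℓ : ℝ, 0 < ℓ → ℓ ≤ a →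
      ∃ χ : Config N → ℝ, ContDiff ℝ 1 χ ∧
        (∀ (X : Config N) (i : Fin N) (k : Fin 3),
          χ (X + Pi.single i (EuclideanSpace.single k L)) = χ X) ∧
        (∀ (σ : Equiv.Perm (Fin N)) (X : Config N), χ (X ∘ σ) = χ X) ∧
        (∀ X, 0 ≤ χ X ∧ χ X ≤ 1) ∧
        (∀ X : Config N,
          (∃ i j : Fin N, i ≠ j ∧ ∃ n : Fin 3 → ℤ, ‖X i - X j - latticeVec L n‖ ≤ a) → χ X = 0) ∧
        (∀ X : Config N,
          (∀ i j : Fin N, i ≠ j → ∀ n : Fin 3 → ℤ, a + ℓ ≤ ‖X i - X j - latticeVec L n‖) →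
            χ X = 1) ∧
        (∀ X : Config N, kineticDensity (fun Y => (χ Y : ℂ)) X ≤ ENNReal.ofReal (C / ℓ ^ 2)) ∧
        (∀ X : Config N, (∀ i j : Fin N, i ≠ j → ∀ n : Fin 3 → ℤ,
            ‖X i - X j - latticeVec L n‖ ≤ a ∨ a + ℓ ≤ ‖X i - X j - latticeVec L n‖) →
          kineticDensity (fun Y => (χ Y : ℂ)) X = 0) := by
  intro N L a hL ha
  obtain ⟨M₁, hM₁0, hM₁⟩ : ∃ M : ℝ, 0 ≤ M ∧ ∀ t, |deriv Real.smoothTransition t| ≤ M := by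
    obtain ⟨M, hM0, hM⟩ := exists_bound_deriv_smoothTransition
    refine ⟨M, hM0, fun t => ?_⟩
    rcases le_or_gt t 0 with ht | ht
    · rw [deriv_smoothTransition_of_nonpos ht, abs_zero]; exact hM0
    rcases le_or_gt 1 t with ht' | ht'
    · rw [deriv_smoothTransition_of_one_le ht', abs_zero]; exact hM0
    · exact hM t ⟨ht.le, ht'.le⟩
  obtain ⟨K, hK⟩ := exists_card_latticeVec_near_le hL (2 * a)
  refine ⟨3 * N * (4 * N ^ 2 * K * M₁ ^ 2) ^ 2, by positivity, fun ℓ hℓ hℓa => ?_⟩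
  obtain ⟨φ, hφC, hφ0, -, hφa, hφaℓ, hφB, hφ'0⟩ := exists_sqProfile ha hℓ hM₁
  have hρ : 0 ≤ a + ℓ := by positivity
  have hd0 : 0 < (a + ℓ) ^ 2 - a ^ 2 := by nlinarith
  have hsTC : ContDiff ℝ 1 Real.smoothTransition := Real.smoothTransition.contDiff
  have hwR : ∀ r, a + ℓ < r → ENNReal.ofReal (φ (r ^ 2)) = 0 := fun r hr => by
    rw [hφaℓ _ (pow_le_pow_left₀ hρ hr.le 2), ENNReal.ofReal_zero]
  have hwfin : ∀ r, ENNReal.ofReal (φ (r ^ 2)) ≠ ⊤ := fun _ => ENNReal.ofReal_ne_top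
  have hwC : ContDiff ℝ 1 fun y : Space => (ENNReal.ofReal (φ (‖y‖ ^ 2))).toReal := by
    have : (fun y : Space => (ENNReal.ofReal (φ (‖y‖ ^ 2))).toReal) = fun y => φ (‖y‖ ^ 2) :=
      funext fun y => ENNReal.toReal_ofReal (hφ0 _)
    exact this ▸ hφC.comp (contDiff_norm_sq ℝ)
  have hHC : ContDiff ℝ 1 fun X : Config N =>
      (periodicInteraction (fun r => ENNReal.ofReal (φ (r ^ 2))) L X).toReal :=
    contDiff_toReal_periodicInteraction hL hwR hwfin hwC
  have hφ'ρ : ∀ s, (a + ℓ) ^ 2 ≤ s → deriv φ s = 0 := fun s hs => hφ'0 s (Or.inr hs)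
  have hKρ : ∀ (y : Space) (s : Finset (Fin 3 → ℤ)),
      (∀ n ∈ s, ‖y - latticeVec L n‖ ≤ a + ℓ) → s.card ≤ K := fun y s hs =>
    hK y s fun n hn => (hs n hn).trans (by linarith)
  have hχd : Differentiable ℝ fun X : Config N => Real.smoothTransition (1 -
      (periodicInteraction (fun r => ENNReal.ofReal (φ (r ^ 2))) L X).toReal) :=
    (hsTC.comp (contDiff_const.sub hHC)).differentiable one_ne_zero
  have hχ' : ∀ X : Config N, HasFDerivAt (fun Y : Config N => Real.smoothTransition (1 -
      (periodicInteraction (fun r => ENNReal.ofReal (φ (r ^ 2))) L Y).toReal))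
      (deriv Real.smoothTransition (1 -
        (periodicInteraction (fun r => ENNReal.ofReal (φ (r ^ 2))) L X).toReal) •
        (0 - fderiv ℝ (fun Y : Config N =>
          (periodicInteraction (fun r => ENNReal.ofReal (φ (r ^ 2))) L Y).toReal) X)) X := fun X =>
    ((hsTC.differentiable one_ne_zero) _).hasDerivAt.comp_hasFDerivAt X
      ((hasFDerivAt_const (1 : ℝ) X).sub ((hHC.differentiable one_ne_zero) X).hasFDerivAt)
  have hgrad : ∀ (X : Config N) (i : Fin N) (k : Fin 3),
      |fderiv ℝ (fun Y : Config N => Real.smoothTransition (1 -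
        (periodicInteraction (fun r => ENNReal.ofReal (φ (r ^ 2))) L Y).toReal)) X
          (Pi.single i (EuclideanSpace.single k (1 : ℝ)))| ≤ 4 * N ^ 2 * K * M₁ ^ 2 / ℓ := by
    intro X i k
    rw [(hχ' X).fderiv, smul_apply, sub_apply, zero_apply, zero_sub, smul_eq_mul, abs_mul, abs_neg]
    have h3 := abs_fderiv_toReal_periodicInteraction_le hL hφC hφ0 hρ hφaℓ hφ'ρ
      (div_nonneg hM₁0 hd0.le) hφB hKρ X (Pi.single i (EuclideanSpace.single k (1 : ℝ)))
    have hv1 : ‖(Pi.single i (EuclideanSpace.single k (1 : ℝ)) : Config N)‖ = 1 := by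
      rw [Pi.norm_single]; simp
    rw [hv1, mul_one] at h3
    refine (mul_le_mul (hM₁ _) h3 (abs_nonneg _) hM₁0).trans ?_
    rw [div_eq_mul_one_div M₁, div_eq_mul_one_div _ ℓ]
    have hkey : (a + ℓ) * (1 / ((a + ℓ) ^ 2 - a ^ 2)) ≤ 1 / ℓ := by
      rw [mul_one_div, div_le_div_iff₀ hd0 hℓ, one_mul]; nlinarith
    have hNK : 0 ≤ (N : ℝ) ^ 2 * K * M₁ * M₁ * 4 := by positivity
    calc M₁ * ((N : ℝ) ^ 2 * K * (M₁ * (1 / ((a + ℓ) ^ 2 - a ^ 2)) * (2 * ((a + ℓ) * 2))))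
        = (N : ℝ) ^ 2 * K * M₁ * M₁ * 4 * ((a + ℓ) * (1 / ((a + ℓ) ^ 2 - a ^ 2))) := by ring
      _ ≤ (N : ℝ) ^ 2 * K * M₁ * M₁ * 4 * (1 / ℓ) := mul_le_mul_of_nonneg_left hkey hNK
      _ = 4 * N ^ 2 * K * M₁ ^ 2 * (1 / ℓ) := by ring
  refine ⟨fun X => Real.smoothTransition (1 -
      (periodicInteraction (fun r => ENNReal.ofReal (φ (r ^ 2))) L X).toReal),
    hsTC.comp (contDiff_const.sub hHC), fun X i k => ?_, fun σ X => ?_,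
    fun X => ⟨Real.smoothTransition.nonneg _, Real.smoothTransition.le_one _⟩,
    fun X hX => ?_, fun X hX => ?_, fun X => ?_, fun X hX => ?_⟩
  · beta_reduce; rw [toReal_periodicInteraction_periodic] -- periodicity
  · beta_reduce -- Bose symmetry
    have : periodicInteraction (fun r => ENNReal.ofReal (φ (r ^ 2))) L (X ∘ σ) =
        periodicInteraction (fun r => ENNReal.ofReal (φ (r ^ 2))) L X :=
      periodicInteraction_comp_equiv _ L σ X
    rw [this]
  · obtain ⟨i, j, hij, n, hn⟩ := hX -- an image pair at distance `≤ a` forces `H ≥ 1`, `χ = 0`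
    refine Real.smoothTransition.zero_of_nonpos (sub_nonpos.2 ?_)
    have h1 : (1 : ℝ≥0∞) ≤ periodicInteraction (fun r => ENNReal.ofReal (φ (r ^ 2))) L X := by
      have h := apply_le_periodicInteraction (fun r => ENNReal.ofReal (φ (r ^ 2))) L X hij n
      rwa [hφa _ (pow_le_pow_left₀ (norm_nonneg _) hn 2), ENNReal.ofReal_one] at h
    have := ENNReal.toReal_mono (ENNReal.sum_ne_top.2 fun _ _ => ENNReal.sum_ne_top.2 fun _ _ =>
      periodizedPotential_ne_top hL hwR hwfin _) h1
    rwa [ENNReal.toReal_one] at this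
  · beta_reduce -- all image pairs at distance `≥ a + ℓ` force `H = 0`, `χ = 1`
    rw [periodicInteraction_eq_zero_of_forall _ L X fun i j hij n => by
      rw [hφaℓ _ (pow_le_pow_left₀ hρ (hX i j hij n) 2), ENNReal.ofReal_zero],
      ENNReal.toReal_zero, sub_zero]
    exact Real.smoothTransition.one_of_one_le le_rfl
  · beta_reduce -- the gradient bound
    rw [kineticDensity_ofReal hχd, realKinetic_eq_ofReal]
    refine ENNReal.ofReal_le_ofReal ?_
    calc ∑ i : Fin N, ∑ k : Fin 3, (fderiv ℝ (fun Y : Config N => Real.smoothTransition (1 -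
            (periodicInteraction (fun r => ENNReal.ofReal (φ (r ^ 2))) L Y).toReal)) X
              (Pi.single i (EuclideanSpace.single k (1 : ℝ)))) ^ 2
        ≤ ∑ _i : Fin N, ∑ _k : Fin 3, (4 * N ^ 2 * K * M₁ ^ 2 / ℓ) ^ 2 :=
          Finset.sum_le_sum fun i _ => Finset.sum_le_sum fun k _ =>
            (sq_abs _).symm.trans_le (pow_le_pow_left₀ (abs_nonneg _) (hgrad X i k) 2)
      _ = 3 * N * (4 * N ^ 2 * K * M₁ ^ 2) ^ 2 / ℓ ^ 2 := by
          simp only [Finset.sum_const, Finset.card_univ, Fintype.card_fin, nsmul_eq_mul]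
          rw [div_pow]; push_cast; ring
  · beta_reduce -- off the shells the gradient vanishes
    rw [kineticDensity_ofReal hχd, realKinetic_eq_ofReal, (hχ' X).fderiv,
      fderiv_toReal_periodicInteraction_eq_zero hL hφC hφ0 hρ hφaℓ X fun i j hij n =>
        (hX i j hij n).elim (fun h => hφ'0 _ (Or.inl (pow_le_pow_left₀ (norm_nonneg _) h 2)))
          fun h => hφ'0 _ (Or.inr (pow_le_pow_left₀ hρ h 2)), sub_zero, smul_zero]
    simp

end Summit.AtomisticToContinuum.BoseEinsteinCondensation.Cruxes.HardCoreExtension.ThirdLawCurrentFloor
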